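import Summits.QuantumFields.YangMills.Theorems.BalabanLadderNTCeilingPricePackage
import HarnessLib

/-!
# Crux `NT` (stmt-QuantumFields-19353), stub `stub_refpkgT : RefPkgT`: the one-point ceiling prices the floors, IV —
# the THREE-point collar law `δ' ≤ 4·2^{1/6} κ`

Helper file (`--supports stmt-QuantumFields-19353`) of the fleet lead prover of crux `NT` (unit `ym-spine-19353-p1`,
GEN 12); sequel of `…NTCeilingPricePackage` (two-point collar law `δ ≤ 2^{1/8}κ`).  Hypothesis-free, general compact `G`, any
`r`, any unit map `a > 0` with `a → 0`.

The registered clause-5 margin contains, besides the E2- and E3-terms, the pure one-point term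
`2k³·S_fS_gS_h` (`k = C₁(s/κ)⁴`), separation-BLIND; the clause-1 cap of `…NTCeilingPriceSmeared` is
`|Q3(f,g,h)| ≤ S_fS_gS_h(2C₁/R⁴)³`, separation-CRITICAL (`R ≈ δ'/(4s)`, `δ'` the pairwise support separation).  With the SAME
`S_fS_gS_h` on both sides every envelope cancels:

* `tripleSum_kkk_le` — the registered clause-5 margin is at least `2(C₁(s/κ)⁴)³ S_f S_g S_h` (`C₁, C₂, C₃ ≥ 0`);
* `mul_lt_of_marginFloor₃_le_cap` — window arithmetic: `ε + 2C₁³(s/κ)¹²SSS + (≥ 0) ≤ X ≤ SSS(2C₁/R⁴)³`, `ε > 0` ⇒ `s·R < 2^{1/6}κ`;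
* **`sep_lt_of_clause5_at`** — at one coupling, the registered clause-5 inequality VERBATIM on a collar-large reference torus
  (`2σ ≤ sL`, `δ' ≤ sL`) under clause 1 forces `δ'/4 − 3s < 2^{1/6} κ`;
* **`sep_le_collar₃`** — β-uniformly **`δ' ≤ 4·2^{1/6} κ ≈ 4.49 κ`**: the three clause-5 witnesses must be pairwise within `4.49`
  collar widths (`< 2.25 ℓ`; the factor `4` is the `ℓ² → ℓ^∞` and `2R+4 ≤ sep` bookkeeping of `torusSep_of_sep`).

HONEST FRAMING.  Real arithmetic and limits over the sequels; CONDITIONAL on clause 1; no floor, not AF, not NT, not the seam,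
not the gap; not Clay.
-/

set_option autoImplicit false

noncomputable section

open scoped SchwartzMap
open MeasureTheory Filter Topology
open Literature.MathematicalPhysics.QuantumFieldTheory Literature.MathematicalPhysics.QuantumLattice
open Literature.Probability.LatticeModels
open Summit.QuantumFields.YangMills.Cruxes.OSLegsFromFemtoAndGap.DlrCollarTransfer

namespace Summit.QuantumFields.YangMills.Cruxes.NT.CeilingPrice

/-! ## §1 Arithmetic -/

/-- `(2^{1/6})¹² = 4`. [folklore] -/
theorem two_rpow_sixth_pow_twelve : ((2 : ℝ) ^ (1 / 6 : ℝ)) ^ (12 : ℕ) = 4 := by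
  rw [← Real.rpow_natCast, ← Real.rpow_mul (by norm_num : (0 : ℝ) ≤ 2)]
  norm_num

/-- **The registered clause-5 margin dominates its pure one-point part**: with non-negative weights `F, G, H` and
`C₁, C₂, C₃ ≥ 0`, the triple sum of the registered per-triple margin is at least `2k³ · (ΣF)(ΣG)(ΣH)`, `k = C₁ t`
(`t = (s/κ)⁴ ≥ 0`). [folklore] -/
theorem tripleSum_kkk_le {ι : Type*} (S : Finset ι) (F G' H : ι → ℝ) (hF : ∀ x, 0 ≤ F x) (hG : ∀ y, 0 ≤ G' y)
    (hH : ∀ z, 0 ≤ H z) {C₁ C₂ C₃ t : ℝ} (hC₁ : 0 ≤ C₁) (hC₂ : 0 ≤ C₂) (hC₃ : 0 ≤ C₃) (ht : 0 ≤ t)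
    (w₁ w₂ w₃ m : ι → ι → ι → ℝ) (hw₁ : ∀ x y z, 0 ≤ w₁ x y z) (hw₂ : ∀ x y z, 0 ≤ w₂ x y z)
    (hw₃ : ∀ x y z, 0 ≤ w₃ x y z) (hm : ∀ x y z, 0 ≤ m x y z) :
    (∑ x ∈ S, F x) * (∑ y ∈ S, G' y) * (∑ z ∈ S, H z) * (2 * (C₁ * t) ^ 3) ≤
      ∑ x ∈ S, ∑ y ∈ S, ∑ z ∈ S, F x * G' y * H z *
        (2 * ((C₁ * t) * (C₂ * t / w₁ x y z) + (C₁ * t) * (C₂ * t / w₂ x y z) + (C₁ * t) * (C₂ * t / w₃ x y z) +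
              (C₁ * t) * (C₁ * t) * (C₁ * t)) + C₃ * t / m x y z) := by
  rw [Finset.sum_mul_sum, Finset.sum_mul, Finset.sum_mul]
  refine Finset.sum_le_sum fun x _ => ?_
  rw [Finset.sum_mul, Finset.sum_mul]
  refine Finset.sum_le_sum fun y _ => ?_
  rw [Finset.mul_sum, Finset.sum_mul]
  refine Finset.sum_le_sum fun z _ => ?_
  have hk : 0 ≤ C₁ * t := mul_nonneg hC₁ ht
  have hFGH : 0 ≤ F x * G' y * H z := mul_nonneg (mul_nonneg (hF x) (hG y)) (hH z)
  have h1 : 0 ≤ (C₁ * t) * (C₂ * t / w₁ x y z) := mul_nonneg hk (div_nonneg (mul_nonneg hC₂ ht) (hw₁ x y z))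
  have h2 : 0 ≤ (C₁ * t) * (C₂ * t / w₂ x y z) := mul_nonneg hk (div_nonneg (mul_nonneg hC₂ ht) (hw₂ x y z))
  have h3 : 0 ≤ (C₁ * t) * (C₂ * t / w₃ x y z) := mul_nonneg hk (div_nonneg (mul_nonneg hC₂ ht) (hw₃ x y z))
  have h4 : 0 ≤ C₃ * t / m x y z := div_nonneg (mul_nonneg hC₃ ht) (hm x y z)
  refine mul_le_mul_of_nonneg_left ?_ hFGH
  have e : 2 * (C₁ * t) ^ 3 = 2 * ((C₁ * t) * (C₁ * t) * (C₁ * t)) := by ring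
  rw [e]
  linarith

/-- **The two-sided three-point window on one torus.**  If `ε > 0`, `ε + 2C₁³(s/κ)¹²·P + T ≤ X` with `T ≥ 0`,
`P = S_fS_gS_h ≥ 0`, and `X ≤ P·(2C₁/R⁴)³`, `κ > 0`, `R ≥ 1`, `C₁ ≥ 0`, then `s·R < 2^{1/6}κ`. [folklore] -/
theorem mul_lt_of_marginFloor₃_le_cap {ε C₁ s κ P T X : ℝ} {R : ℕ} (hε : 0 < ε) (hκ : 0 < κ)
    (hC₁ : 0 ≤ C₁) (hP : 0 ≤ P) (hT : 0 ≤ T) (hR : 1 ≤ R)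
    (hfloor : ε + 2 * (C₁ * (s / κ) ^ 4) ^ 3 * P + T ≤ X) (hcap : X ≤ P * (2 * C₁ / (R : ℝ) ^ 4) ^ 3) :
    s * R < (2 : ℝ) ^ (1 / 6 : ℝ) * κ := by
  have hRpos : (0 : ℝ) < R := by exact_mod_cast hR
  set Q := C₁ ^ 3 * P with hQ
  have hQ0 : 0 ≤ Q := by positivity
  have hwin : ε + 2 * Q * (s / κ) ^ 12 ≤ 8 * Q / (R : ℝ) ^ 12 := by
    have e1 : 2 * (C₁ * (s / κ) ^ 4) ^ 3 * P = 2 * Q * (s / κ) ^ 12 := by rw [hQ]; ring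
    have e2 : P * (2 * C₁ / (R : ℝ) ^ 4) ^ 3 = 8 * Q / (R : ℝ) ^ 12 := by rw [hQ]; field_simp; ring
    linarith
  have hQpos : 0 < Q := by
    rcases hQ0.lt_or_eq with h | h
    · exact h
    · exfalso
      rw [← h] at hwin
      simp at hwin
      linarith
  have hlt12 : (s * R / κ) ^ 12 < 4 := by
    have h1 : 2 * Q * (s / κ) ^ 12 < 8 * Q / (R : ℝ) ^ 12 := by linarith
    have h2 : (s / κ) ^ 12 < 4 / (R : ℝ) ^ 12 := by
      have h3 : 2 * Q * (s / κ) ^ 12 < 2 * Q * (4 / (R : ℝ) ^ 12) := by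
        calc 2 * Q * (s / κ) ^ 12 < 8 * Q / (R : ℝ) ^ 12 := h1
          _ = 2 * Q * (4 / (R : ℝ) ^ 12) := by ring
      exact lt_of_mul_lt_mul_left h3 (by positivity)
    have h4 : (s * R / κ) ^ 12 = (s / κ) ^ 12 * (R : ℝ) ^ 12 := by ring
    rw [h4]
    calc (s / κ) ^ 12 * (R : ℝ) ^ 12 < 4 / (R : ℝ) ^ 12 * (R : ℝ) ^ 12 :=
        mul_lt_mul_of_pos_right h2 (by positivity)
      _ = 4 := div_mul_cancel₀ 4 (by positivity)
  have hroot : s * R / κ < (2 : ℝ) ^ (1 / 6 : ℝ) := by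
    by_contra hge
    have hge := le_of_not_gt hge
    have h2pos : (0 : ℝ) ≤ (2 : ℝ) ^ (1 / 6 : ℝ) := by positivity
    have := pow_le_pow_left₀ h2pos hge 12
    rw [two_rpow_sixth_pow_twelve] at this
    linarith
  rwa [div_lt_iff₀ hκ] at hroot

/-- The three-point collar radius `R = ⌊δ'/4/s⌋₊ − 2` (`0 < s`, `3s < δ'/4`): `1 ≤ R`, `4(R+2)s ≤ δ'`, `(2R+3)s ≤ δ'/2 − s`,
`(4R+8)s ≤ δ'` and `δ'/4 − 3s ≤ sR`. [folklore] -/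
theorem collarRadius₃_spec {δ' s : ℝ} (hs : 0 < s) (h3 : 3 * s < δ' / 4) :
    1 ≤ ⌊δ' / 4 / s⌋₊ - 2 ∧ 4 * ((((⌊δ' / 4 / s⌋₊ - 2 : ℕ) : ℝ) + 2) * s) ≤ δ' ∧
      ((2 * (⌊δ' / 4 / s⌋₊ - 2) + 3 : ℕ) : ℝ) * s ≤ δ' / 2 - s ∧
      (4 * ((⌊δ' / 4 / s⌋₊ - 2 : ℕ) : ℝ) + 8) * s ≤ δ' ∧ δ' / 4 - 3 * s ≤ s * ((⌊δ' / 4 / s⌋₊ - 2 : ℕ) : ℝ) := by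
  obtain ⟨h1, h2, h3', h4⟩ := collarRadius_spec hs h3
  refine ⟨h1, by linarith, by linarith, by nlinarith, h4⟩

/-! ## §2 The three-point collar law -/

section Package

variable (G : Type) [Group G] [TopologicalSpace G] [IsTopologicalGroup G] [CompactSpace G]
  [MeasurableSpace G] [BorelSpace G] (r : LatticeRep G)

/-- **The three-point collar law at one coupling.**  At coupling `β`, spacing `0 < s` with `3s < δ'/4`: clause 1 (E1-osc,
`C₁ ≥ 0`, range `ℓ` with `δ' ≤ 2ℓ`) and the registered clause-5 floor-with-margin (`C₂, C₃ ≥ 0`, `κ > 0`, `ε > 0`) for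
witnesses `f, g, h` in the ball of radius `σ` with pairwise support separation `δ'`, on a collar-large reference torus
(`2σ ≤ sL`, `δ' ≤ sL`), force **`δ'/4 − 3s < 2^{1/6} κ`**. [folklore] -/
theorem sep_lt_of_clause5_at (β : ℝ) {C₁ C₂ C₃ ℓ s κ : ℝ} (hC₁ : 0 ≤ C₁) (hC₂ : 0 ≤ C₂) (hC₃ : 0 ≤ C₃) (hκ : 0 < κ)
    (hs : 0 < s)
    (hE1 : ∀ (c : Fin 4 → ℤ) (b : ℕ), (b : ℝ) * s ≤ ℓ → ∀ (η η' : LGConfig 4 G) (x : Fin 4 → ℤ),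
      1 ≤ depth c b x → |kerE G r β c b η (dens G r x) - kerE G r β c b η' (dens G r x)| ≤ C₁ / (depth c b x : ℝ) ^ 4)
    {f g h : 𝓢(EuclideanSpace ℝ (Fin 4), ℝ)} {δ' σ ε : ℝ} (hε : 0 < ε) (h3 : 3 * s < δ' / 4) (hδ'ℓ : δ' ≤ 2 * ℓ)
    (hfg : ∀ p q : EuclideanSpace ℝ (Fin 4), f p ≠ 0 → g q ≠ 0 → δ' ≤ ‖p - q‖)
    (hgh : ∀ p q : EuclideanSpace ℝ (Fin 4), g p ≠ 0 → h q ≠ 0 → δ' ≤ ‖p - q‖)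
    (hfh : ∀ p q : EuclideanSpace ℝ (Fin 4), f p ≠ 0 → h q ≠ 0 → δ' ≤ ‖p - q‖)
    (hfσ : tsupport (f : EuclideanSpace ℝ (Fin 4) → ℝ) ⊆ Metric.closedBall 0 σ)
    (hgσ : tsupport (g : EuclideanSpace ℝ (Fin 4) → ℝ) ⊆ Metric.closedBall 0 σ)
    (hhσ : tsupport (h : EuclideanSpace ℝ (Fin 4) → ℝ) ⊆ Metric.closedBall 0 σ) {L : ℕ} (hσL : 2 * σ ≤ s * L)
    (hδL : δ' ≤ s * L)
    (hfloor : ε + ∑ x ∈ box 4 L, ∑ y ∈ box 4 L, ∑ z ∈ box 4 L,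
        |f (s • siteToE x)| * |g (s • siteToE y)| * |h (s • siteToE z)| *
          (2 * ((C₁ * (s / κ) ^ 4) * (C₂ * (s / κ) ^ 4 / (1 + ‖siteToE (z - y)‖) ^ 4) +
                (C₁ * (s / κ) ^ 4) * (C₂ * (s / κ) ^ 4 / (1 + ‖siteToE (z - x)‖) ^ 4) +
                (C₁ * (s / κ) ^ 4) * (C₂ * (s / κ) ^ 4 / (1 + ‖siteToE (y - x)‖) ^ 4) +
                (C₁ * (s / κ) ^ 4) * (C₁ * (s / κ) ^ 4) * (C₁ * (s / κ) ^ 4)) +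
            C₃ * (s / κ) ^ 4 / (1 + min (min ‖siteToE (y - x)‖ ‖siteToE (z - y)‖) ‖siteToE (z - x)‖) ^ 8) ≤
      |Q3 G r β L s f g h|) :
    δ' / 4 - 3 * s < (2 : ℝ) ^ (1 / 6 : ℝ) * κ := by
  obtain ⟨hR1, hR2, hR3, hR8, hR4⟩ := collarRadius₃_spec hs h3
  set R : ℕ := ⌊δ' / 4 / s⌋₊ - 2 with hR_def
  have hRℓ : ((2 * R + 3 : ℕ) : ℝ) * s ≤ ℓ := hR3.trans (by linarith)
  have hRL : 4 * R + 8 ≤ L := by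
    have h2 : (4 * (R : ℝ) + 8) * s ≤ s * L := hR8.trans hδL
    have h3' : (4 * (R : ℝ) + 8) ≤ L := by
      rw [mul_comm] at h2; exact le_of_mul_le_mul_left h2 hs
    exact_mod_cast h3'
  have hcap := abs_Q3_le_of_e1osc G r β hC₁ hs hE1 hfg hgh hfh hfσ hgσ hhσ hσL hR1 hRℓ hRL hR2
  have ht : 0 ≤ (s / κ) ^ 4 := by positivity
  have hlow := tripleSum_kkk_le (box 4 L) (fun x => |f (s • siteToE x)|) (fun y => |g (s • siteToE y)|)
    (fun z => |h (s • siteToE z)|) (fun _ => abs_nonneg _) (fun _ => abs_nonneg _) (fun _ => abs_nonneg _)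
    hC₁ hC₂ hC₃ ht (fun x y z => (1 + ‖siteToE (z - y)‖) ^ 4) (fun x y z => (1 + ‖siteToE (z - x)‖) ^ 4)
    (fun x y z => (1 + ‖siteToE (y - x)‖) ^ 4)
    (fun x y z => (1 + min (min ‖siteToE (y - x)‖ ‖siteToE (z - y)‖) ‖siteToE (z - x)‖) ^ 8)
    (fun _ _ _ => by positivity) (fun _ _ _ => by positivity) (fun _ _ _ => by positivity)
    (fun x y z => pow_nonneg (add_nonneg zero_le_one
      (le_min (le_min (norm_nonneg _) (norm_nonneg _)) (norm_nonneg _))) 8)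
  set P := (∑ x ∈ box 4 L, |f (s • siteToE x)|) * (∑ y ∈ box 4 L, |g (s • siteToE y)|) *
    (∑ z ∈ box 4 L, |h (s • siteToE z)|) with hP
  have hP0 : 0 ≤ P := mul_nonneg (mul_nonneg (Finset.sum_nonneg fun _ _ => abs_nonneg _)
    (Finset.sum_nonneg fun _ _ => abs_nonneg _)) (Finset.sum_nonneg fun _ _ => abs_nonneg _)
  -- the registered margin minus its `k³` part is non-negative
  have key := mul_lt_of_marginFloor₃_le_cap (T := _) hε hκ hC₁ hP0 (sub_nonneg.2 hlow) hR1
    (by linarith) hcap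
  exact hR4.trans_lt key

/-- **The three-point collar law, β-uniformly: `δ' ≤ 4·2^{1/6} κ`.**  Let `a > 0`, `a → 0`; assume clause 1 of the
registered package (`C₁ ≥ 0`, range `ℓ`) and its clause 5 (`C₂, C₃ ≥ 0`, `κ > 0`, `ε > 0`) for witnesses `f, g, h` in the
ball of radius `σ` with pairwise support separation `δ' > 0`, `δ' ≤ 2ℓ`, on reference tori `L₀ β` that are collar-large
(`2σ ≤ aβ·L₀β`, `δ' ≤ aβ·L₀β`; in the registered letters: whenever `max (2σ) δ' ≤ σ + κ + 1`).  Then **`δ' ≤ 4·2^{1/6}·κ`**.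
[folklore] -/
theorem sep_le_collar₃ (a : ℝ → ℝ) (ha : ∀ β, 0 < a β) (ha0 : Tendsto a atTop (𝓝 0)) {C₁ C₂ C₃ ℓ κ : ℝ}
    (hC₁ : 0 ≤ C₁) (hC₂ : 0 ≤ C₂) (hC₃ : 0 ≤ C₃) (hκ : 0 < κ)
    (hE1 : ∃ β₁ : ℝ, ∀ β : ℝ, β₁ ≤ β → ∀ (c : Fin 4 → ℤ) (b : ℕ), (b : ℝ) * a β ≤ ℓ →
      ∀ (η η' : LGConfig 4 G) (x : Fin 4 → ℤ), 1 ≤ depth c b x →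
        |kerE G r β c b η (dens G r x) - kerE G r β c b η' (dens G r x)| ≤ C₁ / (depth c b x : ℝ) ^ 4)
    {f g h : 𝓢(EuclideanSpace ℝ (Fin 4), ℝ)} {δ' σ ε : ℝ} (hε : 0 < ε) (hδ' : 0 < δ') (hδ'ℓ : δ' ≤ 2 * ℓ)
    (hfg : ∀ p q : EuclideanSpace ℝ (Fin 4), f p ≠ 0 → g q ≠ 0 → δ' ≤ ‖p - q‖)
    (hgh : ∀ p q : EuclideanSpace ℝ (Fin 4), g p ≠ 0 → h q ≠ 0 → δ' ≤ ‖p - q‖)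
    (hfh : ∀ p q : EuclideanSpace ℝ (Fin 4), f p ≠ 0 → h q ≠ 0 → δ' ≤ ‖p - q‖)
    (hfσ : tsupport (f : EuclideanSpace ℝ (Fin 4) → ℝ) ⊆ Metric.closedBall 0 σ)
    (hgσ : tsupport (g : EuclideanSpace ℝ (Fin 4) → ℝ) ⊆ Metric.closedBall 0 σ)
    (hhσ : tsupport (h : EuclideanSpace ℝ (Fin 4) → ℝ) ⊆ Metric.closedBall 0 σ) {β₅ : ℝ} {L₀ : ℝ → ℕ}
    (hL₀ : ∀ β : ℝ, β₅ ≤ β → 2 * σ ≤ a β * L₀ β ∧ δ' ≤ a β * L₀ β)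
    (hfloor : ∀ β : ℝ, β₅ ≤ β →
      ε + ∑ x ∈ box 4 (L₀ β), ∑ y ∈ box 4 (L₀ β), ∑ z ∈ box 4 (L₀ β),
          |f (a β • siteToE x)| * |g (a β • siteToE y)| * |h (a β • siteToE z)| *
            (2 * ((C₁ * (a β / κ) ^ 4) * (C₂ * (a β / κ) ^ 4 / (1 + ‖siteToE (z - y)‖) ^ 4) +
                  (C₁ * (a β / κ) ^ 4) * (C₂ * (a β / κ) ^ 4 / (1 + ‖siteToE (z - x)‖) ^ 4) +
                  (C₁ * (a β / κ) ^ 4) * (C₂ * (a β / κ) ^ 4 / (1 + ‖siteToE (y - x)‖) ^ 4) +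
                  (C₁ * (a β / κ) ^ 4) * (C₁ * (a β / κ) ^ 4) * (C₁ * (a β / κ) ^ 4)) +
              C₃ * (a β / κ) ^ 4 /
                (1 + min (min ‖siteToE (y - x)‖ ‖siteToE (z - y)‖) ‖siteToE (z - x)‖) ^ 8) ≤
        |Q3 G r β (L₀ β) (a β) f g h|) :
    δ' ≤ 4 * (2 : ℝ) ^ (1 / 6 : ℝ) * κ := by
  obtain ⟨β₁, H1⟩ := hE1
  have hev : ∀ᶠ β in atTop, δ' / 4 - 3 * a β < (2 : ℝ) ^ (1 / 6 : ℝ) * κ := by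
    have hsmall : ∀ᶠ β in atTop, a β < δ' / 4 / 3 := ha0.eventually (gt_mem_nhds (by positivity))
    filter_upwards [hsmall, eventually_ge_atTop β₁, eventually_ge_atTop β₅] with β hβs hβ1 hβ5
    have h3 : 3 * a β < δ' / 4 := by linarith
    obtain ⟨hσL, hδL⟩ := hL₀ β hβ5
    exact sep_lt_of_clause5_at G r β hC₁ hC₂ hC₃ hκ (ha β) (H1 β hβ1) hε h3 hδ'ℓ hfg hgh hfh hfσ hgσ hhσ hσL hδL
      (hfloor β hβ5)
  have hlim : Tendsto (fun β => δ' / 4 - 3 * a β) atTop (𝓝 (δ' / 4 - 3 * 0)) :=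
    tendsto_const_nhds.sub (ha0.const_mul 3)
  rw [mul_zero, sub_zero] at hlim
  have := le_of_tendsto hlim (hev.mono fun β hβ => hβ.le)
  linarith

end Package

end Summit.QuantumFields.YangMills.Cruxes.NT.CeilingPrice

end
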